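import Summits.Ventures.LatticeQCDFlow.Scoring.U1TorusPlaquettePair
import HarnessLib

/-!
# The 2-d `U(1)` torus: `⟨cos² θ_p⟩` and THE VARIANCE OF THE VOLUME-AVERAGED PLAQUETTE, exactly

HONEST FRAMING: exact (Metropolis-corrected) sampling algorithms for lattice gauge theory;
figures of merit are autocorrelation/cost numbers at stated couplings and volumes; no
continuum-physics claim.

Venture `LatticeQCDFlow` (cell pub-lqcd), sub-topic `Scoring`; FANOUT row 5 (`s0-sun-a`), GEN-13.
NEW WORK of the cell (placement rule), continuing `Scoring/U1TorusPlaquettePair.lean` (probe characters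
with multiplicities; the pair correlation `⟨cos θ_p cos θ_q⟩ = P/Z`, `P = Σ_k I_{|k|}^{V−2}(I_k')²`,
`Z = Σ_k I_{|k|}^V`, `I_k' = (I_{|k−1|}+I_{|k+1|})/2`) towards the U(1) analogue of GEN-12's SU(2) error-bar
oracle, for the S0-B keys (`L = 16`, `β = 1,…,7`):

* §1 **the square** (probe `2·𝟙_p`): `∫ cos² θ_p W = (2π)^{n+1} Σ_k (∏_{r≠p} I_{|k|}(β_r)) I_k''(β_p)`,
  `I_k'' = (I_{|k−2|} + 2I_{|k|} + I_{|k+2|})/4`; **`u1WilsonExpect_cos_sq`**; at uniform coupling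
  `⟨cos² θ_p⟩ = S/Z`, `S = Σ_k I_{|k|}^{V−1} I_k''`; on the torus **`torus_u1WilsonExpect_cos_sq`**;
* §2 linearity of the Wilson expectation `u1WilsonExpect` (sums, constants) for continuous observables;
* §3 **the volume-averaged plaquette** `P̄ = (Σ_x cos θ_x)/V` on the `L₁ × L₂` torus, `V = L₁L₂`,
  `N = Σ_k I_{|k|}^{V−1} I_k'`: `⟨P̄⟩ = N/Z` (`torus_u1WilsonExpect_plaquetteAverage`),
  `⟨P̄²⟩ = (S/Z)/V + (1 − 1/V)(P/Z)` (`torus_u1WilsonExpect_plaquetteAverage_sq`), and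
  **`torus_u1WilsonExpect_plaquetteAverage_variance`**:
  `Var(P̄) = ⟨P̄²⟩ − ⟨P̄⟩² = (S/Z)/V + (1 − 1/V)(P/Z) − (N/Z)²` — the exact variance of the observable the
  S0-B samplers report, for every `L₁, L₂ ≥ 1` and every real `β`.

READING (error-bar oracle): an ideal sampler returning `M` independent configurations estimates
`⟨cos θ_p⟩` by `P̄` with standard error `√(Var(P̄)/M)`; a sampler's effective sample size for the
plaquette is `Var(P̄)/σ̂²` with `σ̂` its own error bar.  Bounds, the `V → ∞` law `V·Var(P̄) → 1 − t/β − t²`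
(`t = I₁/I₀`) and kernel enclosures at the S0-B keys are the companion files.  Elementary; nothing is
cited; no `def`.
-/

noncomputable section

open scoped Nat
open Real MeasureTheory Set Finset Literature.Analysis.FunctionSpaces

namespace Summit.Ventures.LatticeQCDFlow.Scoring

section Closed

variable {n : ℕ} {ι : Type*} [Fintype ι] [DecidableEq ι] (inc : ι → Fin (n + 1) → ℤ) (βp : ι → ℝ)

/-! ### 1. The square of one plaquette -/

/-- **The second-moment numerator on a closed connected complex**:
`∫ cos² θ_p W dθ = (2π)^{n+1} Σ_k (∏_{r≠p} I_{|k|}(β_r)) I_k''(β_p)`, `I_k'' = (I_{|k−2|} + 2I_{|k|} + I_{|k+2|})/4`. -/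
theorem setIntegral_cos_sq_mul_weight [Nonempty ι] (hclosed : ∀ l, ∑ p, inc p l = 0)
    (hconn : ∀ m : ι → ℤ, (∀ l, ∑ p, m p * inc p l = 0) → ∀ p q, m p = m q) (p : ι) :
    ∫ θ in u1TorusBox (n + 1), Real.cos (u1PlaqAngle inc p θ) ^ 2 * u1WilsonWeight univ inc βp θ =
      (2 * π) ^ (n + 1) * ∑' k : ℤ, (∏ r ∈ univ.erase p, besselI k.natAbs (βp r)) *
        ((besselI (k - 2).natAbs (βp p) + 2 * besselI k.natAbs (βp p) +
          besselI (k + 2).natAbs (βp p)) / 4) := by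
  set s2 : ι → ℤ := fun r => if r = p then 2 else 0 with hs2
  have h2 : ∀ θ : Fin (n + 1) → ℝ, ∑ r, (s2 r : ℝ) * u1PlaqAngle inc r θ = 2 * u1PlaqAngle inc p θ :=
    fun θ => by
    simp only [hs2, Int.cast_ite, Int.cast_ofNat, Int.cast_zero, ite_mul, zero_mul, Finset.sum_ite_eq',
      Finset.mem_univ, if_true]
  have hcos : ∀ θ : Fin (n + 1) → ℝ,
      Real.cos (u1PlaqAngle inc p θ) ^ 2 * u1WilsonWeight univ inc βp θ =
        1 / 2 * u1WilsonWeight univ inc βp θ +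
          1 / 2 * (Real.cos (∑ r, (s2 r : ℝ) * u1PlaqAngle inc r θ) * u1WilsonWeight univ inc βp θ) :=
    fun θ => by rw [h2, Real.cos_sq]; ring
  have hW := continuous_u1WilsonWeight univ inc βp
  have hA := fun r => continuous_u1PlaqAngle inc r
  have hI1 : Integrable (u1WilsonWeight univ inc βp)
      ((volume : Measure (Fin (n + 1) → ℝ)).restrict (u1TorusBox (n + 1))) :=
    integrableOn_u1TorusBox' hW
  have hI2 : Integrable (fun θ : Fin (n + 1) → ℝ =>
      Real.cos (∑ r, (s2 r : ℝ) * u1PlaqAngle inc r θ) * u1WilsonWeight univ inc βp θ)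
      ((volume : Measure (Fin (n + 1) → ℝ)).restrict (u1TorusBox (n + 1))) :=
    integrableOn_u1TorusBox' (by fun_prop)
  have hZ : ∫ θ in u1TorusBox (n + 1), u1WilsonWeight univ inc βp θ =
      (2 * π) ^ (n + 1) * ∑' k : ℤ, ∏ r, besselI k.natAbs (βp r) :=
    u1WilsonZ_eq_tsum_const inc βp hclosed hconn
  simp_rw [hcos]
  rw [integral_add (hI1.const_mul _) (hI2.const_mul _), MeasureTheory.integral_const_mul,
    MeasureTheory.integral_const_mul, hZ, setIntegral_cos_mult_mul_weight inc βp hclosed hconn s2]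
  have hs2_p : s2 p = 2 := by simp [hs2]
  have hs2_r : ∀ r ∈ univ.erase p, s2 r = 0 := fun r hr => by
    simp [hs2, Finset.ne_of_mem_erase hr]
  have e0 : ∀ k : ℤ, ∏ r, besselI k.natAbs (βp r) =
      besselI k.natAbs (βp p) * ∏ r ∈ univ.erase p, besselI k.natAbs (βp r) := fun k => by
    rw [← Finset.mul_prod_erase univ _ (Finset.mem_univ p)]
  have e1 : ∀ k : ℤ, ∏ r, besselI (k - s2 r).natAbs (βp r) =
      besselI (k - 2).natAbs (βp p) * ∏ r ∈ univ.erase p, besselI k.natAbs (βp r) := fun k => by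
    rw [← Finset.mul_prod_erase univ _ (Finset.mem_univ p), hs2_p]
    congr 1
    exact Finset.prod_congr rfl fun r hr => by rw [hs2_r r hr, sub_zero]
  have e2 : ∀ k : ℤ, ∏ r, besselI (k + s2 r).natAbs (βp r) =
      besselI (k + 2).natAbs (βp p) * ∏ r ∈ univ.erase p, besselI k.natAbs (βp r) := fun k => by
    rw [← Finset.mul_prod_erase univ _ (Finset.mem_univ p), hs2_p]
    congr 1
    exact Finset.prod_congr rfl fun r hr => by rw [hs2_r r hr, add_zero]
  have hs0 : Summable fun k : ℤ => ∏ r, besselI k.natAbs (βp r) := by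
    have h := summable_prod_besselI_sub_mult βp (0 : ι → ℤ)
    simp only [Pi.zero_apply, sub_zero] at h
    exact h
  have hs1 := summable_prod_besselI_sub_mult βp s2
  have hs3 : Summable fun k : ℤ => ∏ r, besselI (k + s2 r).natAbs (βp r) := by
    have h := summable_prod_besselI_sub_mult βp (-s2)
    simp only [Pi.neg_apply, sub_neg_eq_add] at h
    exact h
  have hS1 : Summable fun k : ℤ => ((∏ r, besselI (k - s2 r).natAbs (βp r)) +
      ∏ r, besselI (k + s2 r).natAbs (βp r)) / 2 := (hs1.add hs3).div_const 2
  rw [← mul_assoc, ← mul_assoc, mul_comm (1 / 2 : ℝ), mul_assoc, mul_assoc, ← mul_add,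
    ← tsum_mul_left, ← tsum_mul_left, ← (hs0.mul_left _).tsum_add (hS1.mul_left _)]
  congr 1
  refine tsum_congr fun k => ?_
  rw [e0, e1, e2]
  ring

/-- **The second moment of the plaquette on a closed connected complex**:
`⟨cos² θ_p⟩ = Σ_k (∏_{r≠p} I_{|k|}(β_r)) I_k''(β_p) / Σ_k ∏_r I_{|k|}(β_r)`. -/
theorem u1WilsonExpect_cos_sq [Nonempty ι] (hclosed : ∀ l, ∑ p, inc p l = 0)
    (hconn : ∀ m : ι → ℤ, (∀ l, ∑ p, m p * inc p l = 0) → ∀ p q, m p = m q) (p : ι) :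
    u1WilsonExpect univ inc βp (fun θ => Real.cos (u1PlaqAngle inc p θ) ^ 2) =
      (∑' k : ℤ, (∏ r ∈ univ.erase p, besselI k.natAbs (βp r)) *
        ((besselI (k - 2).natAbs (βp p) + 2 * besselI k.natAbs (βp p) +
          besselI (k + 2).natAbs (βp p)) / 4)) /
        ∑' k : ℤ, ∏ r, besselI k.natAbs (βp r) := by
  rw [u1WilsonExpect, setIntegral_cos_sq_mul_weight inc βp hclosed hconn p,
    u1WilsonZ_eq_tsum_const inc βp hclosed hconn,
    mul_div_mul_left _ _ (by positivity : (2 * π : ℝ) ^ (n + 1) ≠ 0)]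

/-- **Uniform coupling** (`V = #ι`): `⟨cos² θ_p⟩ = Σ_k I_{|k|}^{V−1} I_k'' / Σ_k I_{|k|}^V`,
`I_k'' = (I_{|k−2|} + 2I_{|k|} + I_{|k+2|})/4`. -/
theorem u1WilsonExpect_cos_sq_uniform [Nonempty ι] (hclosed : ∀ l, ∑ p, inc p l = 0)
    (hconn : ∀ m : ι → ℤ, (∀ l, ∑ p, m p * inc p l = 0) → ∀ p q, m p = m q) (β : ℝ) (p : ι) :
    u1WilsonExpect univ inc (fun _ => β) (fun θ => Real.cos (u1PlaqAngle inc p θ) ^ 2) =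
      (∑' k : ℤ, besselI k.natAbs β ^ (Fintype.card ι - 1) *
          ((besselI (k - 2).natAbs β + 2 * besselI k.natAbs β + besselI (k + 2).natAbs β) / 4)) /
        ∑' k : ℤ, besselI k.natAbs β ^ Fintype.card ι := by
  rw [u1WilsonExpect_cos_sq inc _ hclosed hconn p]
  simp only [Finset.prod_const, Finset.card_erase_of_mem (Finset.mem_univ p), Finset.card_univ]

end Closed

/-! ### 2. Linearity of the Wilson expectation -/

section Linear

variable {n : ℕ} {ι : Type*} (Ps : Finset ι) (inc : ι → Fin (n + 1) → ℤ) (βp : ι → ℝ)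

/-- `⟨Σ_i f_i⟩ = Σ_i ⟨f_i⟩` for continuous observables. -/
theorem u1WilsonExpect_finset_sum {κ : Type*} (T : Finset κ) (f : κ → (Fin (n + 1) → ℝ) → ℝ)
    (hf : ∀ i, Continuous (f i)) :
    u1WilsonExpect Ps inc βp (fun θ => ∑ i ∈ T, f i θ) = ∑ i ∈ T, u1WilsonExpect Ps inc βp (f i) := by
  unfold u1WilsonExpect
  rw [← Finset.sum_div]
  congr 1
  have hW := continuous_u1WilsonWeight Ps inc βp
  simp_rw [Finset.sum_mul]
  rw [integral_finsetSum]
  exact fun i _ => integrableOn_u1TorusBox ((hf i).mul hW)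

/-- `⟨c·f⟩ = c·⟨f⟩`. -/
theorem u1WilsonExpect_const_mul (c : ℝ) (f : (Fin (n + 1) → ℝ) → ℝ) :
    u1WilsonExpect Ps inc βp (fun θ => c * f θ) = c * u1WilsonExpect Ps inc βp f := by
  unfold u1WilsonExpect
  simp_rw [mul_assoc]
  rw [MeasureTheory.integral_const_mul, mul_div_assoc]

/-- `⟨c⟩ = c`. -/
theorem u1WilsonExpect_const (c : ℝ) : u1WilsonExpect Ps inc βp (fun _ => c) = c := by
  unfold u1WilsonExpect
  rw [MeasureTheory.integral_const_mul]
  exact mul_div_cancel_right₀ c (u1WilsonZ_pos Ps inc βp).ne'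

end Linear

/-! ### 3. The volume-averaged plaquette of the `L₁ × L₂` torus -/

section Torus

variable {L₁ L₂ : ℕ} [NeZero L₁] [NeZero L₂] {n : ℕ}
  (e : Fin 2 × (Fin L₁ × Fin L₂) ≃ Fin (n + 1))

/-- **THE SECOND MOMENT OF THE PLAQUETTE OF THE 2-d `U(1)` TORUS.**  For every `L₁, L₂ ≥ 1`, real `β`
and plaquette `x`:
`⟨cos² θ_x⟩_{L₁×L₂,β} = Σ_k I_{|k|}(β)^{L₁L₂−1} (I_{|k−2|}(β) + 2I_{|k|}(β) + I_{|k+2|}(β))/4 / Σ_k I_{|k|}(β)^{L₁L₂}`. -/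
theorem torus_u1WilsonExpect_cos_sq (β : ℝ) (x : Fin L₁ × Fin L₂) :
    u1WilsonExpect univ (torusInc e) (fun _ => β)
        (fun θ => Real.cos (u1PlaqAngle (torusInc e) x θ) ^ 2) =
      (∑' k : ℤ, besselI k.natAbs β ^ (L₁ * L₂ - 1) *
          ((besselI (k - 2).natAbs β + 2 * besselI k.natAbs β + besselI (k + 2).natAbs β) / 4)) /
        ∑' k : ℤ, besselI k.natAbs β ^ (L₁ * L₂) := by
  rw [u1WilsonExpect_cos_sq_uniform _ (torusInc_closed e) (torusInc_conn e) β x]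
  simp [Fintype.card_prod, Fintype.card_fin]


/-- **The mean of the volume-averaged plaquette** `P̄ = (Σ_x cos θ_x)/(L₁L₂)` is the plaquette:
`⟨P̄⟩_{L₁×L₂,β} = Σ_k I_{|k|}^{V−1} I_k' / Σ_k I_{|k|}^V` (`V = L₁L₂`). -/
theorem torus_u1WilsonExpect_plaquetteAverage (β : ℝ) :
    u1WilsonExpect univ (torusInc e) (fun _ => β)
        (fun θ => (∑ x, Real.cos (u1PlaqAngle (torusInc e) x θ)) / ((L₁ * L₂ : ℕ) : ℝ)) =
      (∑' k : ℤ, besselI k.natAbs β ^ (L₁ * L₂ - 1) *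
          ((besselI (k - 1).natAbs β + besselI (k + 1).natAbs β) / 2)) /
        ∑' k : ℤ, besselI k.natAbs β ^ (L₁ * L₂) := by
  have hV : ((L₁ * L₂ : ℕ) : ℝ) ≠ 0 := by
    have := NeZero.ne L₁; have := NeZero.ne L₂; positivity
  have hA := fun x => continuous_u1PlaqAngle (torusInc e) x
  have hfun : (fun θ : Fin (n + 1) → ℝ => (∑ x, Real.cos (u1PlaqAngle (torusInc e) x θ)) / ((L₁ * L₂ : ℕ) : ℝ)) =
      fun θ => (1 / ((L₁ * L₂ : ℕ) : ℝ)) * ∑ x, Real.cos (u1PlaqAngle (torusInc e) x θ) := by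
    funext θ; ring
  rw [hfun, u1WilsonExpect_const_mul, u1WilsonExpect_finset_sum _ _ _ _ _ (fun x => by fun_prop)]
  simp_rw [torus_u1WilsonExpect_cos_plaq e β]
  rw [Finset.sum_const, Finset.card_univ, nsmul_eq_mul, Fintype.card_prod, Fintype.card_fin,
    Fintype.card_fin]
  field_simp

/-- **The second moment of the volume-averaged plaquette**: with `V = L₁L₂`, `Z = Σ_k I_{|k|}^V`,
`S = Σ_k I_{|k|}^{V−1} I_k''`, `P = Σ_k I_{|k|}^{V−2} (I_k')²`:
`⟨P̄²⟩_{L₁×L₂,β} = (S/Z)/V + (1 − 1/V)·(P/Z)` (the `V` diagonal terms and the `V(V−1)` equal pair terms). -/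
theorem torus_u1WilsonExpect_plaquetteAverage_sq (β : ℝ) :
    u1WilsonExpect univ (torusInc e) (fun _ => β)
        (fun θ => ((∑ x, Real.cos (u1PlaqAngle (torusInc e) x θ)) / ((L₁ * L₂ : ℕ) : ℝ)) ^ 2) =
      (∑' k : ℤ, besselI k.natAbs β ^ (L₁ * L₂ - 1) *
            ((besselI (k - 2).natAbs β + 2 * besselI k.natAbs β + besselI (k + 2).natAbs β) / 4)) /
          (∑' k : ℤ, besselI k.natAbs β ^ (L₁ * L₂)) / ((L₁ * L₂ : ℕ) : ℝ) +
        (1 - 1 / ((L₁ * L₂ : ℕ) : ℝ)) *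
          ((∑' k : ℤ, besselI k.natAbs β ^ (L₁ * L₂ - 2) *
              ((besselI (k - 1).natAbs β + besselI (k + 1).natAbs β) / 2) ^ 2) /
            ∑' k : ℤ, besselI k.natAbs β ^ (L₁ * L₂)) := by
  have hV : ((L₁ * L₂ : ℕ) : ℝ) ≠ 0 := by
    have := NeZero.ne L₁; have := NeZero.ne L₂; positivity
  have hA := fun x => continuous_u1PlaqAngle (torusInc e) x
  -- abbreviations for the three exact values
  set S := (∑' k : ℤ, besselI k.natAbs β ^ (L₁ * L₂ - 1) *
      ((besselI (k - 2).natAbs β + 2 * besselI k.natAbs β + besselI (k + 2).natAbs β) / 4)) /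
    ∑' k : ℤ, besselI k.natAbs β ^ (L₁ * L₂) with hS
  set P := (∑' k : ℤ, besselI k.natAbs β ^ (L₁ * L₂ - 2) *
      ((besselI (k - 1).natAbs β + besselI (k + 1).natAbs β) / 2) ^ 2) /
    ∑' k : ℤ, besselI k.natAbs β ^ (L₁ * L₂) with hP
  have hfun : (fun θ : Fin (n + 1) → ℝ =>
      ((∑ x, Real.cos (u1PlaqAngle (torusInc e) x θ)) / ((L₁ * L₂ : ℕ) : ℝ)) ^ 2) =
      fun θ => (1 / ((L₁ * L₂ : ℕ) : ℝ) ^ 2) * ∑ x, ∑ y,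
        Real.cos (u1PlaqAngle (torusInc e) x θ) * Real.cos (u1PlaqAngle (torusInc e) y θ) := by
    funext θ
    rw [div_pow, sq (∑ x, Real.cos (u1PlaqAngle (torusInc e) x θ)), Finset.sum_mul_sum]
    ring
  rw [hfun, u1WilsonExpect_const_mul, u1WilsonExpect_finset_sum _ _ _ _ _ (fun x => by fun_prop)]
  have hinner : ∀ x : Fin L₁ × Fin L₂,
      u1WilsonExpect univ (torusInc e) (fun _ => β) (fun θ => ∑ y,
        Real.cos (u1PlaqAngle (torusInc e) x θ) * Real.cos (u1PlaqAngle (torusInc e) y θ)) =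
      S + (((L₁ * L₂ : ℕ) : ℝ) - 1) * P := fun x => by
    rw [u1WilsonExpect_finset_sum _ _ _ _ _ (fun y => by fun_prop),
      ← Finset.add_sum_erase univ _ (Finset.mem_univ x)]
    congr 1
    · rw [hS, ← torus_u1WilsonExpect_cos_sq e β x]
      congr 1
      funext θ
      ring
    · rw [Finset.sum_congr rfl fun y hy =>
        torus_u1WilsonExpect_cos_mul_cos e β (Finset.ne_of_mem_erase hy).symm,
        Finset.sum_const, Finset.card_erase_of_mem (Finset.mem_univ x), Finset.card_univ,
        nsmul_eq_mul, Fintype.card_prod, Fintype.card_fin, Fintype.card_fin, ← hP]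
      have h1 : 1 ≤ L₁ * L₂ := Nat.one_le_iff_ne_zero.mpr (by
        have := NeZero.ne L₁; have := NeZero.ne L₂; positivity)
      rw [Nat.cast_sub h1, Nat.cast_one]
  simp_rw [hinner]
  rw [Finset.sum_const, Finset.card_univ, nsmul_eq_mul, Fintype.card_prod, Fintype.card_fin,
    Fintype.card_fin]
  field_simp

/-- **THE VARIANCE OF THE VOLUME-AVERAGED PLAQUETTE OF THE 2-d `U(1)` TORUS.**  For every
`L₁, L₂ ≥ 1` and every real `β`, with `P̄ = (Σ_x cos θ_x)/V`, `V = L₁L₂`, `Z = Σ_k I_{|k|}(β)^V`,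
`N = Σ_k I_{|k|}^{V−1} I_k'`, `P = Σ_k I_{|k|}^{V−2} (I_k')²`, `S = Σ_k I_{|k|}^{V−1} I_k''`
(`I_k' = (I_{|k−1|}+I_{|k+1|})/2`, `I_k'' = (I_{|k−2|}+2I_{|k|}+I_{|k+2|})/4`):
`Var(P̄) = ⟨P̄²⟩ − ⟨P̄⟩² = (S/Z)/V + (1 − 1/V)(P/Z) − (N/Z)²`. -/
theorem torus_u1WilsonExpect_plaquetteAverage_variance (β : ℝ) :
    u1WilsonExpect univ (torusInc e) (fun _ => β)
          (fun θ => ((∑ x, Real.cos (u1PlaqAngle (torusInc e) x θ)) / ((L₁ * L₂ : ℕ) : ℝ)) ^ 2) -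
        u1WilsonExpect univ (torusInc e) (fun _ => β)
          (fun θ => (∑ x, Real.cos (u1PlaqAngle (torusInc e) x θ)) / ((L₁ * L₂ : ℕ) : ℝ)) ^ 2 =
      (∑' k : ℤ, besselI k.natAbs β ^ (L₁ * L₂ - 1) *
            ((besselI (k - 2).natAbs β + 2 * besselI k.natAbs β + besselI (k + 2).natAbs β) / 4)) /
          (∑' k : ℤ, besselI k.natAbs β ^ (L₁ * L₂)) / ((L₁ * L₂ : ℕ) : ℝ) +
        (1 - 1 / ((L₁ * L₂ : ℕ) : ℝ)) *
          ((∑' k : ℤ, besselI k.natAbs β ^ (L₁ * L₂ - 2) *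
              ((besselI (k - 1).natAbs β + besselI (k + 1).natAbs β) / 2) ^ 2) /
            ∑' k : ℤ, besselI k.natAbs β ^ (L₁ * L₂)) -
        ((∑' k : ℤ, besselI k.natAbs β ^ (L₁ * L₂ - 1) *
            ((besselI (k - 1).natAbs β + besselI (k + 1).natAbs β) / 2)) /
          ∑' k : ℤ, besselI k.natAbs β ^ (L₁ * L₂)) ^ 2 := by
  rw [torus_u1WilsonExpect_plaquetteAverage_sq, torus_u1WilsonExpect_plaquetteAverage]

end Torus

end Summit.Ventures.LatticeQCDFlow.Scoring
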